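import Summits.BirchSwinnertonDyer.Rank1Residual.Supersingular.KobayashiMainConjecture
import Summits.BirchSwinnertonDyer.Rank1Residual.Supersingular.SprungPollackConsistency
import Literature.NumberTheory.EllipticCurves.Sprung2012.ColemanPairUniqueProofs
import Literature.NumberTheory.EllipticCurves.PAdicBSDSkinnerUrbanProofs
import Summits.BirchSwinnertonDyer.BirchSwinnertonDyer.Theorems.ThetaPartnerAtTwoSignedKatoUpToAtTwoInvolFunctionalEquation
import HarnessLib

/-!
# Route `ThetaPartnerAtTwo` (TP2), crux K3 `SignedKatoDivisibilityUpToAtTwo` (item stmt-BirchSwinnertonDyer-20308), line `colemanrat`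
# v10 — GLUE «Coleman pair ⟸ Mazur–Tate congruences»: the `Λ`-algebra under the finite-level form of the PUB stub CORE

Width seat `bsd-wall-tp2-p2x-w2` g5 (cell `bsd-wall`). HONEST FRAMING: theorems only (no definition, no named fact, no instance,
no `sorry`); helper algebra for the sequel `…CoreOfFiniteErl.lean` (`core_of_coreFin : CORE_fin → CORE`); closes no item; K3 is
NOT settled and BSD is NOT proved by any of this.

## What is here (all in `Λ = ℤ_p⟦T⟧`, `p` any prime unless stated)

* §1 `exists_eq_omega_mul_of_C_pow_mul_eq` — **`p^M x ∈ ω_n Λ ⇒ x ∈ ω_n Λ`** (`ω_n ∉ (p)`; a copy of the private helper of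
  `Sprung2017/SharpFlatPAdicLFunctionUniqueProofs`, with its two sub-lemmas);
  `omega_dvd_of_isSprungPair_of_congr` — from a Sprung pair `(A, B)` (`θ_n ≡ −(u_n A + v_n B) (mod ω_n)` in `Λ ⊗ ℚ_p`,
  `Sprung2017.IsSprungPair`) and a congruence `P ≡ μ θ_n (mod ω_n)` in `Λ ⊗ ℚ_p` (a `p`-power allowed, as in `IsCongrModOmega`)
  to the INTEGRAL divisibility `ω_n ∣ P + u_n (μA) + v_n (μB)`;
  `mul_eq_mul_of_dvd_of_dvd` — if `(L♯', L♭')` is a chromatic limit of `(P_n)` and `(μA, μB)` one of `(ν P_n)` then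
  `ν L♯' = μ A`, `ν L♭' = μ B` (the differences are a chromatic limit of the zero sequence; `Sprung2017.IsChromaticLimit.unique`,
  `p ∣ a_p`); `lengthAt_quotient_span_singleton_mul_of_not_mem` — `ℓ_𝔭(R/(μ x)) = ℓ_𝔭(R/(x))` for `μ ∉ 𝔭`.
* §2 at `p = 2`, trace `a₂ = 0`, for a functional `z` on the local tower points and a plus Honda system `d`:
  `lengthAt_flat_eq_of_isColemanPair_mul` — (COL) «`Col(z) = (μL⁺, μL⁻)`, `μ ∉ 𝔭`» ⇒ every Coleman pair `(L♯', L♭')` of `z`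
  (`Sprung2012.IsColemanPair`) has `ℓ_𝔭(Λ/(L♭')) = ℓ_𝔭(Λ/(L⁻))` (`L⁻ = kobayashiL 1 L⁺ L⁻`, `Invol.kobayashiL_one`);
  `lengthAt_flat_eq_of_congr_mazurTate` — (ERL_fin) «`ν P_{n,d_n}(z) ≡ μ θ_n (mod ω_n)` in `Λ ⊗ ℚ₂` for all `n`, `μ, ν ∉ 𝔭`» and a
  Pollack pair `(L⁺, L⁻)` ⇒ the same conclusion (`isSprungPair_zero_iff`: a Pollack pair is a Sprung pair for trace `0`).
No existence of Coleman pairs, no `α, β`, no functional equation is used. Sources of the SHAPES: Sprung 2012 Def. 3.1 (`P_{n,x}`),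
Def. 5.9 (`Col`), Prop. 5.7 (uniqueness), Prop. 6.3–6.5 (`P_{n,c_n}(z_Kato)` vs `L(E,ψ,1)`); Sprung 2017 Thm. 1.12 / Cor. 4.4;
Kobayashi 2003 Thm. 6.3, Prop. 8.25; Pollack 2003 Prop. 6.18.

References: [Sprung2012] Def. 3.1 (p. 1489), Prop. 5.7 (p. 1494), Def. 5.9 (p. 1495), Prop. 6.3–6.5 (pp. 1496–1497); [Sprung2017]
Thm. 1.12, Cor. 4.4; [Kobayashi2003] Thm. 6.3 (p. 11), (3.6) (p. 7), Prop. 8.25; [Pollack2003] Prop. 6.18.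
-/

set_option autoImplicit false
-- the Theorems namespace of this sub repeats the summit name by design (D-0017 nested layout)
set_option linter.dupNamespace false

noncomputable section

open scoped Classical MatrixGroups ModularForm NumberField

open CongruenceSubgroup WeierstrassCurve Field IsDedekindDomain NumberField Polynomial
  Literature.NumberTheory.GaloisRepresentations
  Literature.NumberTheory.EllipticCurves Literature.NumberTheory.EllipticCurves.Module
  Literature.NumberTheory.EllipticCurves.Kobayashi2003
  Literature.NumberTheory.EllipticCurves.Sprung2012 Literature.NumberTheory.EllipticCurves.Sprung2017
  ZpExtension Summit.BirchSwinnertonDyer.Rank1Residual.Supersingular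

namespace Summit.BirchSwinnertonDyer.BirchSwinnertonDyer.Theorems.SignedKatoOffTwo.CoreFin

/-! ## §1 `Λ`-algebra: `p`-powers are removable modulo `ω_n`; congruences with `θ_n` give divisibilities -/

section Lambda

variable {p : ℕ} [hp : Fact p.Prime]

/-- The coefficient of `T^{pⁿ}` in `ω_n = (1+T)^{pⁿ} − 1 ∈ ℤ[T]` is `1`. [folklore] -/
theorem coeff_cyclotomicOmega_self (n : ℕ) : (cyclotomicOmega p n).coeff (p ^ n) = 1 := by
  have hne : p ^ n ≠ 0 := (pow_pos hp.out.pos n).ne'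
  rw [cyclotomicOmega, coeff_sub, coeff_X_add_one_pow, Nat.choose_self, coeff_one, if_neg hne]
  simp

/-- If `ω_n · r = p · y` in `Λ = ℤ_p⟦T⟧` then `p` divides every coefficient of `r` (reduce to the domain `𝔽_p⟦T⟧`, where `ω_n ≠ 0`).
(Copy of a private helper of `Sprung2017/SharpFlatPAdicLFunctionUniqueProofs`.) [folklore] -/
theorem dvd_coeff_of_omega_mul_eq_C_mul (n : ℕ) {r y : PowerSeries ℤ_[p]}
    (h : ((cyclotomicOmega p n).map (Int.castRingHom ℤ_[p]) : PowerSeries ℤ_[p]) * r =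
      PowerSeries.C (p : ℤ_[p]) * y) (j : ℕ) :
    (p : ℤ_[p]) ∣ PowerSeries.coeff j r := by
  set φ : PowerSeries ℤ_[p] →+* PowerSeries (ZMod p) := PowerSeries.map (PadicInt.toZMod (p := p))
    with hφ
  have hφp : φ (PowerSeries.C (p : ℤ_[p])) = 0 := by
    rw [hφ, PowerSeries.map_C, map_natCast, ZMod.natCast_self, map_zero]
  have hω : φ ((cyclotomicOmega p n).map (Int.castRingHom ℤ_[p]) : PowerSeries ℤ_[p]) ≠ 0 := by
    intro h0
    have h1 := congrArg (PowerSeries.coeff (p ^ n)) h0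
    rw [hφ, PowerSeries.coeff_map, Polynomial.coeff_coe, Polynomial.coeff_map,
      coeff_cyclotomicOmega_self, map_one, map_one, map_zero] at h1
    exact one_ne_zero h1
  have hprod : φ ((cyclotomicOmega p n).map (Int.castRingHom ℤ_[p]) : PowerSeries ℤ_[p]) * φ r = 0 := by
    rw [← map_mul, h, map_mul, hφp, zero_mul]
  have hr : φ r = 0 := (mul_eq_zero.mp hprod).resolve_left hω
  have hj := congrArg (PowerSeries.coeff j) hr
  rw [hφ, PowerSeries.coeff_map, map_zero] at hj
  have hmem : PowerSeries.coeff j r ∈ RingHom.ker (PadicInt.toZMod (p := p)) := hj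
  rwa [PadicInt.ker_toZMod, PadicInt.maximalIdeal_eq_span_p, Ideal.mem_span_singleton] at hmem

/-- The constant `p ∈ Λ` is non-zero. [folklore] -/
theorem C_natCast_ne_zero : (PowerSeries.C (p : ℤ_[p]) : PowerSeries ℤ_[p]) ≠ 0 := by
  intro h0
  have h1 : (p : ℤ_[p]) = 0 := PowerSeries.C_injective (h0.trans (map_zero _).symm)
  exact hp.out.ne_zero (by exact_mod_cast h1)

/-- **`p^M · x ∈ ω_n Λ ⇒ x ∈ ω_n Λ`** in `Λ = ℤ_p⟦T⟧` (`ω_n` is prime to `p`). (Copy of a private helper of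
`Sprung2017/SharpFlatPAdicLFunctionUniqueProofs`.) [folklore] -/
theorem exists_eq_omega_mul_of_C_pow_mul_eq (n : ℕ) :
    ∀ (M : ℕ) {x r : PowerSeries ℤ_[p]},
      PowerSeries.C ((p : ℤ_[p]) ^ M) * x =
        ((cyclotomicOmega p n).map (Int.castRingHom ℤ_[p]) : PowerSeries ℤ_[p]) * r →
      ∃ r' : PowerSeries ℤ_[p],
        x = ((cyclotomicOmega p n).map (Int.castRingHom ℤ_[p]) : PowerSeries ℤ_[p]) * r' := by
  intro M
  induction M with
  | zero =>
    intro x r h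
    exact ⟨r, by simpa using h⟩
  | succ M ih =>
    intro x r h
    have hdiv : ∀ j, (p : ℤ_[p]) ∣ PowerSeries.coeff j r := fun j ↦
      dvd_coeff_of_omega_mul_eq_C_mul n (y := PowerSeries.C ((p : ℤ_[p]) ^ M) * x)
        (by rw [← h, pow_succ', map_mul, mul_assoc]) j
    choose c hc using hdiv
    have hr : r = PowerSeries.C (p : ℤ_[p]) * PowerSeries.mk c := by
      ext j
      rw [PowerSeries.coeff_C_mul, PowerSeries.coeff_mk]
      exact hc j
    have h2 : PowerSeries.C (p : ℤ_[p]) * (PowerSeries.C ((p : ℤ_[p]) ^ M) * x) =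
        PowerSeries.C (p : ℤ_[p]) *
          (((cyclotomicOmega p n).map (Int.castRingHom ℤ_[p]) : PowerSeries ℤ_[p]) *
            PowerSeries.mk c) := by
      rw [← mul_assoc, ← map_mul, ← pow_succ', h, hr]
      ring
    exact ih (mul_left_cancel₀ C_natCast_ne_zero h2)

/-- **From a Sprung pair and a finite-level congruence to an INTEGRAL divisibility.** If `(A, B)` is a Sprung pair for `f` at `p`
(`θ_n ≡ −(u_n A + v_n B) (mod ω_n)` in `Λ ⊗ ℚ_p`) and `P ∈ Λ` satisfies `P ≡ μ·θ_n (mod ω_n)` in `Λ ⊗ ℚ_p` (some `p^m (μ θ_n − P) ∈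
ω_n Λ`), then `ω_n ∣ P + u_n (μA) + v_n (μB)` in `Λ` — the `p`-powers cancel because `ω_n ∉ (p)`.
[cite: Sprung2017, Thm. 1.12 (uniqueness) and Cor. 4.4] -/
theorem omega_dvd_of_isSprungPair_of_congr {N : ℕ} {f : CuspForm (Gamma0 N) 2} {ap : ℤ}
    {A B μ : IwasawaAlgebra p} (hSP : IsSprungPair f p ap A B) {P : IwasawaAlgebra p} {n : ℕ}
    (hP : ∃ (m : ℕ) (q : IwasawaAlgebra p),
      PowerSeries.C ((p : ℚ_[p]) ^ m) *
          (iwasawaToPowerSeries p μ * ((mazurTateElement f p n).map (algebraMap ℚ ℚ_[p]) : PowerSeries ℚ_[p]) -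
            iwasawaToPowerSeries p P) =
        iwasawaToPowerSeries p (((cyclotomicOmega p n).map (Int.castRingHom ℤ_[p]) : PowerSeries ℤ_[p]) * q)) :
    toIwasawa p (cyclotomicOmega p n) ∣
      P + (toIwasawa p (sharpPoly ap p n) * (μ * A) + toIwasawa p (flatPoly ap p n) * (μ * B)) := by
  obtain ⟨m₁, q₁, e₁⟩ := hSP n
  obtain ⟨m₂, q₂, e₂⟩ := hP
  have hneg : (((-1 : ℤ[X]).map (Int.castRingHom ℤ_[p]) : ℤ_[p][X]) : PowerSeries ℤ_[p]) = -1 := by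
    rw [Polynomial.map_neg, Polynomial.map_one, Polynomial.coe_neg, Polynomial.coe_one]
  rw [hneg] at e₁
  have key : iwasawaToPowerSeries p (PowerSeries.C ((p : ℤ_[p]) ^ (m₁ + m₂)) *
      (P + μ * (toIwasawa p (sharpPoly ap p n) * A + toIwasawa p (flatPoly ap p n) * B))) =
      iwasawaToPowerSeries p (((cyclotomicOmega p n).map (Int.castRingHom ℤ_[p]) : PowerSeries ℤ_[p]) *
        (PowerSeries.C ((p : ℤ_[p]) ^ m₂) * μ * q₁ - PowerSeries.C ((p : ℤ_[p]) ^ m₁) * q₂)) := by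
    simp only [map_mul, map_add, map_sub, map_neg, map_one, iwasawaToPowerSeries_C_natCast_pow, pow_add] at e₁ e₂ ⊢
    linear_combination (PowerSeries.C ((p : ℚ_[p]) ^ m₂) * iwasawaToPowerSeries p μ) * e₁ -
      (PowerSeries.C ((p : ℚ_[p]) ^ m₁)) * e₂
  obtain ⟨r, hr⟩ := exists_eq_omega_mul_of_C_pow_mul_eq n (m₁ + m₂) (iwasawaToPowerSeries_injective p key)
  refine ⟨r, ?_⟩
  rw [toIwasawa_apply (cyclotomicOmega p n), ← hr]
  ring

/-- **Two chromatic limits of proportional sequences are proportional.** If `ω_n ∣ P_n + u_n L♯ + v_n L♭` and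
`ω_n ∣ ν P_n + u_n (μA) + v_n (μB)` for every `n` (`p ∣ a_p`), then `ν L♯ = μ A` and `ν L♭ = μ B`: the differences are a chromatic
limit of the zero sequence, and chromatic limits are unique (Sprung's `𝔐`-adic argument, `Sprung2017.IsChromaticLimit.unique`).
[cite: Sprung2017, Thm. 1.12 (uniqueness)] [cite: Sprung2012, Prop. 5.7 (p. 1494)] -/
theorem mul_eq_mul_of_dvd_of_dvd {ap : ℤ} (hap : (p : ℤ) ∣ ap) {P : ℕ → IwasawaAlgebra p}
    {Ls Lf A B μ ν : IwasawaAlgebra p}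
    (h₁ : ∀ n, toIwasawa p (cyclotomicOmega p n) ∣
      P n + (toIwasawa p (sharpPoly ap p n) * Ls + toIwasawa p (flatPoly ap p n) * Lf))
    (h₂ : ∀ n, toIwasawa p (cyclotomicOmega p n) ∣
      ν * P n + (toIwasawa p (sharpPoly ap p n) * (μ * A) + toIwasawa p (flatPoly ap p n) * (μ * B))) :
    ν * Ls = μ * A ∧ ν * Lf = μ * B := by
  have hlim : IsChromaticLimit p ap (fun _ ↦ (0 : ℤ_[p][X])) (ν * Ls - μ * A) (ν * Lf - μ * B) := by
    intro n
    obtain ⟨Q₁, hQ₁⟩ := h₁ n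
    obtain ⟨Q₂, hQ₂⟩ := h₂ n
    refine ⟨ν * Q₁ - Q₂, ?_⟩
    rw [Polynomial.coe_zero, zero_add, ← toIwasawa_apply (cyclotomicOmega p n)]
    linear_combination ν * hQ₁ - hQ₂
  have hzero : IsChromaticLimit p ap (fun _ ↦ (0 : ℤ_[p][X])) 0 0 := fun n ↦
    ⟨0, by simp only [Polynomial.coe_zero, mul_zero, zero_add]⟩
  obtain ⟨ha, hb⟩ := hlim.unique hap hzero
  exact ⟨sub_eq_zero.mp ha, sub_eq_zero.mp hb⟩

/-- `ℓ_𝔭(R/(μ·x)) = ℓ_𝔭(R/(x))` for `μ ∉ 𝔭` in a domain `R`: `0 → R/(x) → R/(μx) → R/(μ) → 0` and `(R/(μ))_𝔭 = 0`. [folklore] -/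
theorem lengthAt_quotient_span_singleton_mul_of_not_mem {R : Type*} [CommRing R] [IsDomain R] {μ : R} (x : R)
    (𝔭 : PrimeSpectrum R) (hμ : μ ∉ 𝔭.asIdeal) :
    lengthAt R (R ⧸ Ideal.span {μ * x}) 𝔭 = lengthAt R (R ⧸ Ideal.span {x}) 𝔭 := by
  have hμ0 : μ ≠ 0 := fun h ↦ hμ (by rw [h]; exact 𝔭.asIdeal.zero_mem)
  rw [lengthAt_quotient_span_singleton_mul x hμ0 𝔭,
    lengthAt_quotient_eq_zero_of_not_le (by rwa [Ideal.span_singleton_le_iff_mem]), zero_add]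

/-- Lengths at `𝔭` of `Λ/(L♭')` and `Λ/(B)` agree when `ν L♭' = μ B` with `μ, ν ∉ 𝔭`. [folklore] -/
theorem lengthAt_quotient_eq_of_mul_eq_mul {Lf B μ ν : IwasawaAlgebra p} (𝔭 : PrimeSpectrum (IwasawaAlgebra p))
    (hμ : μ ∉ 𝔭.asIdeal) (hν : ν ∉ 𝔭.asIdeal) (h : ν * Lf = μ * B) :
    lengthAt (IwasawaAlgebra p) (IwasawaAlgebra p ⧸ Ideal.span {Lf}) 𝔭 =
      lengthAt (IwasawaAlgebra p) (IwasawaAlgebra p ⧸ Ideal.span {B}) 𝔭 := by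
  rw [← lengthAt_quotient_span_singleton_mul_of_not_mem Lf 𝔭 hν, h,
    lengthAt_quotient_span_singleton_mul_of_not_mem B 𝔭 hμ]

end Lambda

/-! ## §2 At `p = 2`, `a₂ = 0`: the ♭-length of ANY Coleman pair of a functional whose pairing values are congruent to `μ θ_n` -/

section Two

variable {v : HeightOneSpectrum (𝓞 ℚ)} {W : WeierstrassCurve ℚ} {κ : ZpExtension ℚ 2}
  {N : ℕ} {f : CuspForm (Gamma0 N) 2} {Lplus Lminus : IwasawaAlgebra 2}
  {g : absoluteGaloisGroup (v.adicCompletion ℚ)} {d : ℕ → localPoints W (v.adicCompletion ℚ)}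
  {z : localTowerPointsOfEmb κ (closureEmb (K := ℚ) (v.adicCompletion ℚ)) W →+ ℤ_[2]}

/-- **(COL) ⇒ (ERL♭).** If `Col(z) = (μ L⁺, μ L⁻)` for a `𝔭`-unit `μ` (`IsColemanPair … z (μ L⁺) (μ L⁻)`, trace `a₂ = 0`), then EVERY
Coleman pair `(L♯', L♭')` of `z` has `ℓ_𝔭(Λ/(L♭')) = ℓ_𝔭(Λ/(L⁻))` (uniqueness of the Coleman value, Sprung 2012 Prop. 5.7, needs only
`2 ∣ a₂`). [cite: Sprung2012, Prop. 5.7 (p. 1494) and Def. 5.9 (p. 1495)] [cite: Kobayashi2003, Thm. 6.3 (p. 11)] -/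
theorem lengthAt_flat_eq_of_isColemanPair_mul {μ : IwasawaAlgebra 2} (𝔭 : PrimeSpectrum (IwasawaAlgebra 2))
    (hμ : μ ∉ 𝔭.asIdeal)
    (hcol : IsColemanPair κ (closureEmb (K := ℚ) (v.adicCompletion ℚ)) W 0 g d z (μ * Lplus) (μ * Lminus))
    {Ls Lf : IwasawaAlgebra 2} (h : IsColemanPair κ (closureEmb (K := ℚ) (v.adicCompletion ℚ)) W 0 g d z Ls Lf) :
    lengthAt (IwasawaAlgebra 2) (IwasawaAlgebra 2 ⧸ Ideal.span {Lf}) 𝔭 =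
      lengthAt (IwasawaAlgebra 2) (IwasawaAlgebra 2 ⧸ Ideal.span {kobayashiL 1 Lplus Lminus}) 𝔭 := by
  have h1 : (1 : IwasawaAlgebra 2) ∉ 𝔭.asIdeal := (Ideal.ne_top_iff_one _).mp 𝔭.isPrime.ne_top
  rw [Invol.kobayashiL_one]
  refine lengthAt_quotient_eq_of_mul_eq_mul 𝔭 hμ h1 ?_
  exact (mul_eq_mul_of_dvd_of_dvd (p := 2) (ap := 0) (dvd_zero 2) (P := fun n ↦
    pairingSum W (localTowerPointsOfEmb κ (closureEmb (K := ℚ) (v.adicCompletion ℚ)) W) g n (d n) z) h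
    (fun n ↦ by rw [one_mul]; exact hcol n)).2

/-- **(ERL_fin) ⇒ (ERL♭).** If `ν · P_{n,d_n}(z) ≡ μ · θ_n (mod ω_n)` in `Λ ⊗ ℚ₂` for every `n`, with `μ, ν ∈ Λ` prime to `𝔭`, and
`(L⁺, L⁻)` is a Pollack pair of `f` at `2`, then every Coleman pair `(L♯', L♭')` of `z` (trace `0`) has `ℓ_𝔭(Λ/(L♭')) = ℓ_𝔭(Λ/(L⁻))`:
Pollack ⇒ Sprung pair for trace `0`; `2`-powers removed; `(ν L♯', ν L♭') = (μ L⁺, μ L⁻)` by uniqueness of chromatic limits.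
[cite: Sprung2012, Prop. 5.7, Def. 5.9, Prop. 6.3–6.5 (pp. 1494–1497)] [cite: Pollack2003, Prop. 6.18] [cite: Kobayashi2003, Thm. 6.3 (p. 11), Prop. 8.25] -/
theorem lengthAt_flat_eq_of_congr_mazurTate [NeZero N] {μ ν : IwasawaAlgebra 2} (𝔭 : PrimeSpectrum (IwasawaAlgebra 2))
    (hμ : μ ∉ 𝔭.asIdeal) (hν : ν ∉ 𝔭.asIdeal) (hPol : IsPollackPair f 2 Lplus Lminus)
    (hfin : ∀ n : ℕ, ∃ (m : ℕ) (q : IwasawaAlgebra 2),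
      PowerSeries.C ((2 : ℚ_[2]) ^ m) *
          (iwasawaToPowerSeries 2 μ * ((mazurTateElement f 2 n).map (algebraMap ℚ ℚ_[2]) : PowerSeries ℚ_[2]) -
            iwasawaToPowerSeries 2 (ν * pairingSum W (localTowerPointsOfEmb κ (closureEmb (K := ℚ) (v.adicCompletion ℚ)) W)
              g n (d n) z)) =
        iwasawaToPowerSeries 2 (((cyclotomicOmega 2 n).map (Int.castRingHom ℤ_[2]) : PowerSeries ℤ_[2]) * q))
    {Ls Lf : IwasawaAlgebra 2} (h : IsColemanPair κ (closureEmb (K := ℚ) (v.adicCompletion ℚ)) W 0 g d z Ls Lf) :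
    lengthAt (IwasawaAlgebra 2) (IwasawaAlgebra 2 ⧸ Ideal.span {Lf}) 𝔭 =
      lengthAt (IwasawaAlgebra 2) (IwasawaAlgebra 2 ⧸ Ideal.span {kobayashiL 1 Lplus Lminus}) 𝔭 := by
  have hSP : IsSprungPair f 2 0 Lplus Lminus := by
    obtain ⟨-, -, hodd, heven⟩ := hPol
    exact (isSprungPair_zero_iff f 2 Lplus Lminus).mpr ⟨hodd, heven⟩
  rw [Invol.kobayashiL_one]
  refine lengthAt_quotient_eq_of_mul_eq_mul 𝔭 hμ hν ?_
  exact (mul_eq_mul_of_dvd_of_dvd (p := 2) (ap := 0) (dvd_zero 2) (P := fun n ↦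
    pairingSum W (localTowerPointsOfEmb κ (closureEmb (K := ℚ) (v.adicCompletion ℚ)) W) g n (d n) z) h
    (fun n ↦ omega_dvd_of_isSprungPair_of_congr hSP (hfin n))).2

end Two

end Summit.BirchSwinnertonDyer.BirchSwinnertonDyer.Theorems.SignedKatoOffTwo.CoreFin

end
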